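import Summits.ValiantsHypothesis.ValiantsHypothesis.Theorems.SymPencilPerFourOneRowCells
import Summits.ValiantsHypothesis.ValiantsHypothesis.Theorems.SymPencilPerFourBasePointPackage
import Summits.ValiantsHypothesis.ValiantsHypothesis.Theorems.SymPencilSdcPerFourTwentySixCells
import Summits.ValiantsHypothesis.ValiantsHypothesis.Theorems.SymPencilSdcPerFourTwentyFive
import Summits.ValiantsHypothesis.ValiantsHypothesis.Theorems.SymPencilLagrangianInvariant

/-!
# Route `SymPencil` — `sdc(per_4) ≥ 26` given the six-dimensional cell hypothesis `H106₅`
# (the one-row Lagrangian cell `(12, 4, 0)` is DEAD)  (`--supports` stmt-ValiantsHypothesis-5674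
# `SdcSuperquadratic`; rung currency only — nothing here bears on `VP ≠ VNP`)

**Theorem** (`twentySix_le_of_H106₅`).  Assume `H106₅` (no `6`-dimensional `V ⊆ Sing Z(per_4)`
carries a joint family with five squares — the one open cell of the kernel-package table at
sizes `25, 26`, val-width-5674-p3's lane).  Then every symmetric affine determinantal
representation of `per_4` over a field of characteristic `0` has size `≥ 26`; in `sdc` language,
`26 ≤ sdc(per₄)` given `H106₅` (`sdc_perPoly_four_twentySix_le_of_H106₅`; the tree's upper bound is
`29`, `SymPencilSdcPerFourTwentyNine`).

The NEW input is unconditional: the cell `(r, dim V, d) = (12, 4, 0)` of size `25` — a Lagrangian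
space of kernel rows with a ONE-ROW (one-column) kernel, the only cell of size `25` invisible to
every Hessian/`e₂` lever (`per_4` is affine along a row) — is EMPTY
(`false_of_rank_twelve_le_twentyFive`).  Mechanism (val-width-5676-p2 g4's pure-ansatz identity
made unconditional): expand the pencil not at the origin but at the base points `v ∈ V`
(`SymPencilPerFourBasePointPackage`); since `D⁻¹(im b)` stays Lagrangian and `C(v)` vanishes on it,
the cubic base-point moment sees `C(z)` only through `uᵀ C(z) u` (`SymPencilBasePointMoments`),
giving `det(D + tC(v)) Θ(x)[K(v)x] = κ per[v; x + tK(v)x]`; its `t⁰, t¹` coefficients and the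
Lie-stabiliser theorem `stab_{gl₁₂} per[v; ·] = traceless row scalings`
(`SymPencilPerFourRowStabilizer`) force `K(v)` to be a row scaling and then put the four
independent cubics `P_j` in a `3`-dimensional span (`SymPencilPerFourOneRowEndgame`,
`SymPencilPerFourOneRowKernel`, `SymPencilPerFourOneRowCells`).  The other cells of size `≤ 25`
are the tree's: `(8,8,·)` inner rank `≥ 10` (val-width-5674-p2), `(9,7,·)`
(`SymPencilPerFourLowRankSevenSharp`, val-width-5674-p3), `(11,5,·)`
(`SymPencilPerFourHessianBlocks`), `(10,6,·)` = `H106₅` (hypothesis).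

Honest framing: `H106₅` is OPEN (val-width-5674-p3's toric/`R6′` lane); the tree's unconditional
value stays `25 ≤ sdc(per₄) ≤ 29`; the size-`26` cell `(12,4,1)` needs the kernel invariance
beyond the Lagrangian case (separate file); the crux `SdcSuperquadratic` and `VP ≠ VNP` are
untouched.  No definitions, no named facts. [folklore]
-/

noncomputable section

-- single-conjunct layout: Sub = Summit, duplicated namespace component intended
set_option linter.dupNamespace false

namespace Summit.ValiantsHypothesis.ValiantsHypothesis.Theorems.SymPencilSdcPerFourTwentySix

open Matrix MvPolynomial Module
open Literature.Computability.AlgebraicComplexity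
open Summit.ValiantsHypothesis.ValiantsHypothesis.Theorems.SymPencilPerFourBasePointPackage
open Summit.ValiantsHypothesis.ValiantsHypothesis.Theorems.SymPencilPerFourOneRowCells
open Summit.ValiantsHypothesis.ValiantsHypothesis.Theorems.SymPencilLagrangianInvariant
open Summit.ValiantsHypothesis.ValiantsHypothesis.Theorems.SymPencilIsotropicKernelSquaresBilinear
open Summit.ValiantsHypothesis.ValiantsHypothesis.Theorems.SymPencilPerFourHessianBlocks
open Summit.ValiantsHypothesis.ValiantsHypothesis.Theorems.SymPencilPerFourLowRankSevenSharp
open Summit.ValiantsHypothesis.ValiantsHypothesis.Theorems.SymPencilBoxFourEquality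
open Summit.ValiantsHypothesis.ValiantsHypothesis.Theorems.SymPencilSdcPerFourInnerRankNineSquares
open Summit.ValiantsHypothesis.ValiantsHypothesis.Theorems.SymPencilPerFourBlocksEq

variable (K : Type*) [Field K] [CharZero K]

/-- **The Lagrangian one-row cell `(12, 4, 0)` is empty** (unconditional): in the base-point
package of a symmetric affine determinantal representation of `per_4` of size `m ≤ 25`
(characteristic `0`), the space of kernel rows `im bL` is not `12`-dimensional. [folklore] -/
theorem false_of_rank_twelve_le_twentyFive {m : ℕ} (hm : m ≤ 25)
    {i₀ : Fin m} {D : Matrix {i // i ≠ i₀} {i // i ≠ i₀} K}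
    {bL : (Fin 4 × Fin 4 → K) →ₗ[K] ({i // i ≠ i₀} → K)}
    {CL : (Fin 4 × Fin 4 → K) →ₗ[K] Matrix {i // i ≠ i₀} {i // i ≠ i₀} K} {κ : K}
    (hD : IsUnit D.det) (hDs : Dᵀ = D) (hCs : ∀ z, (CL z)ᵀ = CL z) (hκ : κ ≠ 0)
    (hi : ∀ z, bL z ⬝ᵥ D⁻¹ *ᵥ bL z = 0)
    (hii : ∀ z, bL z ⬝ᵥ (D⁻¹ * CL z * D⁻¹) *ᵥ bL z = 0)
    (hiii : ∀ z, D.det * (bL z ⬝ᵥ (D⁻¹ * CL z * D⁻¹ * CL z * D⁻¹) *ᵥ bL z) =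
      -(κ * eval z (perPoly (Fin 4) K)))
    (hcard : Fintype.card {i // i ≠ i₀} + 1 = m)
    (hrn : finrank K (LinearMap.range bL) + finrank K (LinearMap.ker bL) = 16)
    (hN : ∀ v, bL v = 0 → IsUnit (D + CL v).det ∧ ∀ (z : Fin 4 × Fin 4 → K) (s : K),
      κ * eval (v + s • z) (perPoly (Fin 4) K) =
        (Matrix.fromBlocks ((s * 0) • (1 : Matrix Unit Unit K))
          (Matrix.replicateRow Unit (s • bL z)) (Matrix.replicateCol Unit (s • bL z))
          (D + CL v + s • CL z)).det)
    (h12 : finrank K (LinearMap.range bL) = 12) : False := by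
  classical
  -- Lagrangian: `card = 24 = 2 · 12`
  have hranle : 2 * finrank K (LinearMap.range bL) ≤ Fintype.card {i // i ≠ i₀} := by
    have hDis : (D⁻¹)ᵀ = D⁻¹ := by rw [Matrix.transpose_nonsing_inv, hDs]
    have hDiu : IsUnit D⁻¹ :=
      (Matrix.isUnit_iff_isUnit_det _).2 (Matrix.isUnit_nonsing_inv_det_iff.2 hD)
    have h :=
      SymPencilHomogeneousDropRankCodim.rank_add_two_mul_finrank_le_of_quadratic_form_eq_zero
        hDis (LinearMap.range bL) (by rintro _ ⟨z, rfl⟩; exact hi z)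
    rw [Matrix.rank_of_isUnit _ hDiu] at h
    omega
  have hL : Fintype.card {i // i ≠ i₀} = 2 * finrank K (LinearMap.range bL) := by omega
  have hk4 : finrank K (LinearMap.ker bL) = 4 := by omega
  -- `per_4` is affine along the kernel (zero squares), so the kernel is one row or one column
  obtain ⟨c, β, hcβ⟩ := sum_sq_of_isotropic_defect_bilinear hD hDs bL CL hCs
    (fun z => eval z (perPoly (Fin 4) K)) hκ hi hii hiii 0 (by omega)
  have hB : ∀ y ∈ LinearMap.ker bL, ∀ i k j l : Fin 4, i ≠ k → j ≠ l →
      y (i, j) * y (k, l) + y (i, l) * y (k, j) = 0 := fun y hy =>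
    perm_two_blocks_of_sum_sq_swap (ι := Fin 0) (by simp) y
      ⟨c, fun k => (β k).flip y, fun u => by
        obtain ⟨e₀, e₁, he⟩ := hcβ u y (LinearMap.mem_ker.1 hy)
        exact ⟨e₀, e₁, fun s => by simpa only [LinearMap.flip_apply] using he s⟩⟩
  have hinv0 : ∀ v, bL v = 0 → ∀ y ∈ LinearMap.range bL,
      CL v *ᵥ (D⁻¹ *ᵥ y) ∈ LinearMap.range bL := fun v hv y hy =>
    mulVec_mem_range_of_lagrangian hD hDs bL CL hCs hi hii hL v hv y hy
  rcases row_or_col_of_perm_two_blocks (LinearMap.ker bL) hB hk4 with ⟨l, hl⟩ | ⟨c', hc'⟩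
  · exact false_of_row_kernel hD hDs bL CL hCs hκ hii hN hinv0 l
      (fun x hx => hl x (LinearMap.mem_ker.2 hx)) hk4
  · exact false_of_col_kernel hD hDs bL CL hCs hκ hii hN hinv0 c'
      (fun x hx => hc' x (LinearMap.mem_ker.2 hx)) hk4

/-- **`sdc(per_4) ≥ 26` given `H106₅`.**  See the module docstring. [folklore] -/
theorem twentySix_le_of_H106₅
    (H106₅ : ∀ V : Submodule K (Fin 4 × Fin 4 → K),
      (∀ x ∈ V, ∀ (r c : Fin 3 → Fin 4), Function.Injective r → Function.Injective c →
        ((Matrix.of fun i j => x (i, j)).submatrix r c).permanent = 0) →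
      finrank K V = 6 → ∀ (c : Fin 5 → K)
        (β : Fin 5 → ((Fin 4 × Fin 4 → K) →ₗ[K] (Fin 4 × Fin 4 → K) →ₗ[K] K)),
      ¬ (∀ u : Fin 4 × Fin 4 → K, ∀ y ∈ V, ∃ e₀ e₁ : K, ∀ s : K,
          eval (u + s • y) (perPoly (Fin 4) K) = e₀ + s * e₁ + s ^ 2 * ∑ k, c k * (β k u y) ^ 2))
    {m : ℕ} {A : Matrix (Fin m) (Fin m) (MvPolynomial (Fin 4 × Fin 4) K)}
    (hS : A.IsSymm) (hA : IsAffineDetRepr (perPoly (Fin 4) K) A) : 26 ≤ m := by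
  classical
  by_contra hlt
  have hm : m ≤ 25 := by omega
  obtain ⟨i₀, D, bL, CL, κ, hD, hDs, hCs, hκ, hi, hii, hiii, hV4, hcard, hranle, hrn, hkerle,
    hN⟩ := basepoint_package_of_isSymm_isAffineDetRepr_perPoly_four K hS hA
  set V := LinearMap.ker bL with hVdef
  have hV3 : ∀ x ∈ V, ∀ (r c : Fin 3 → Fin 4), Function.Injective r → Function.Injective c →
      ((Matrix.of fun i j => x (i, j)).submatrix r c).permanent = 0 :=
    fun x hx r c hr hc => subperm_vanish_inj_of_succAbove x (hV4 x hx) r c hr hc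
  have family : ∀ d : ℕ, Fintype.card {i // i ≠ i₀} ≤ 2 * finrank K (LinearMap.range bL) + d →
      ∃ (c : Fin d → K) (β : Fin d → ((Fin 4 × Fin 4 → K) →ₗ[K] (Fin 4 × Fin 4 → K) →ₗ[K] K)),
        ∀ u : Fin 4 × Fin 4 → K, ∀ y ∈ V, ∃ e₀ e₁ : K, ∀ s : K,
          eval (u + s • y) (perPoly (Fin 4) K) =
            e₀ + s * e₁ + s ^ 2 * ∑ k, c k * (β k u y) ^ 2 := by
    intro d hd
    obtain ⟨c, β, hcβ⟩ := sum_sq_of_isotropic_defect_bilinear hD hDs bL CL hCs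
      (fun z => eval z (perPoly (Fin 4) K)) hκ hi hii hiii d hd
    exact ⟨c, β, fun u y hy => hcβ u y (LinearMap.mem_ker.1 hy)⟩
  have hr : finrank K (LinearMap.range bL) = 8 ∨ finrank K (LinearMap.range bL) = 9 ∨
      finrank K (LinearMap.range bL) = 10 ∨ finrank K (LinearMap.range bL) = 11 ∨
      finrank K (LinearMap.range bL) = 12 := by omega
  rcases hr with h8 | h9 | h10 | h11 | h12
  · obtain ⟨c, β, hcβ⟩ := family 9 (by omega)
    exact not_joint_nine_squares_fin K V hV3 (by omega) c β hcβ
  · obtain ⟨c, β, hcβ⟩ := family 7 (by omega)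
    refine noLowRank_seven₇ V hV3 (by omega) c fun y hy => ⟨fun k => (β k).flip y, fun u => ?_⟩
    obtain ⟨e₀, e₁, he⟩ := hcβ u y hy
    exact ⟨e₀, e₁, fun s => by simpa only [LinearMap.flip_apply] using he s⟩
  · obtain ⟨c, β, hcβ⟩ := family 5 (by omega)
    exact H106₅ V hV3 (by omega) c β hcβ
  · obtain ⟨c, β, hcβ⟩ := family 3 (by omega)
    have h4 := finrank_le_four_of_sum_sq_swap (ι := Fin 3) (by rw [Fintype.card_fin]; norm_num) V
      fun y hy => ⟨c, fun k => (β k).flip y, fun u => by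
        obtain ⟨e₀, e₁, he⟩ := hcβ u y hy
        exact ⟨e₀, e₁, fun s => by simpa only [LinearMap.flip_apply] using he s⟩⟩
    omega
  · exact false_of_rank_twelve_le_twentyFive K hm hD hDs hCs hκ hi hii hiii hcard hrn hN h12

/-- **No symmetric affine determinantal representation of `per_4` of size `≤ 25`, given `H106₅`.**
[folklore] -/
theorem false_of_le_twentyFive_of_H106₅
    (H106₅ : ∀ V : Submodule K (Fin 4 × Fin 4 → K),
      (∀ x ∈ V, ∀ (r c : Fin 3 → Fin 4), Function.Injective r → Function.Injective c →
        ((Matrix.of fun i j => x (i, j)).submatrix r c).permanent = 0) →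
      finrank K V = 6 → ∀ (c : Fin 5 → K)
        (β : Fin 5 → ((Fin 4 × Fin 4 → K) →ₗ[K] (Fin 4 × Fin 4 → K) →ₗ[K] K)),
      ¬ (∀ u : Fin 4 × Fin 4 → K, ∀ y ∈ V, ∃ e₀ e₁ : K, ∀ s : K,
          eval (u + s • y) (perPoly (Fin 4) K) = e₀ + s * e₁ + s ^ 2 * ∑ k, c k * (β k u y) ^ 2))
    {m : ℕ} (hm : m ≤ 25) {A : Matrix (Fin m) (Fin m) (MvPolynomial (Fin 4 × Fin 4) K)}
    (hS : A.IsSymm) (hA : IsAffineDetRepr (perPoly (Fin 4) K) A) : False := by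
  have h := twentySix_le_of_H106₅ K H106₅ hS hA
  omega

/-- **`26 ≤ sdc(per₄)` given `H106₅`** (the tree's unconditional window is `25 ≤ sdc(per₄) ≤ 29`,
`SymPencilSdcPerFourTwentyNine.sdc_perPoly_four_window_twentyNine`). [folklore] -/
theorem sdc_perPoly_four_twentySix_le_of_H106₅
    (H106₅ : ∀ V : Submodule K (Fin 4 × Fin 4 → K),
      (∀ x ∈ V, ∀ (r c : Fin 3 → Fin 4), Function.Injective r → Function.Injective c →
        ((Matrix.of fun i j => x (i, j)).submatrix r c).permanent = 0) →
      finrank K V = 6 → ∀ (c : Fin 5 → K)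
        (β : Fin 5 → ((Fin 4 × Fin 4 → K) →ₗ[K] (Fin 4 × Fin 4 → K) →ₗ[K] K)),
      ¬ (∀ u : Fin 4 × Fin 4 → K, ∀ y ∈ V, ∃ e₀ e₁ : K, ∀ s : K,
          eval (u + s • y) (perPoly (Fin 4) K) = e₀ + s * e₁ + s ^ 2 * ∑ k, c k * (β k u y) ^ 2)) :
    26 ≤ symmDeterminantalComplexity (perPoly (Fin 4) K) := by
  letI : Invertible (2 : K) := invertibleOfNonzero two_ne_zero
  obtain ⟨A, hS, hA⟩ :=
    hasSymmDetRepr_symmDeterminantalComplexity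
      ⟨_, SymPencilSdcPerThreeWindow.hasSymmDetRepr_perPoly_quarez K 4⟩
  exact twentySix_le_of_H106₅ K H106₅ hS hA

end Summit.ValiantsHypothesis.ValiantsHypothesis.Theorems.SymPencilSdcPerFourTwentySix

end
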